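import Literature.Analysis.FunctionSpaces.TorusClassicalNSDifferenceBalances
import Literature.Analysis.FunctionSpaces.TorusLinearisedNSEnergy
import Literature.Analysis.ODE.LogConvexityBackwardUniqueness
import HarnessLib

/-!
# Backward uniqueness of classical Navier–Stokes solutions on the flat torus

Function-space support file (all results proved; no definitions, no named facts) for the accepted
notion `Torus.IsClassicalNSSolutionOn S ν f u p` (`TorusFluidGlue`), continuing
`TorusClassicalNSUniqueness` (forward uniqueness by the energy method) and
`TorusClassicalNSDifferenceBalances` (energy / enstrophy identities for the difference of two
solutions). Main results:

* `Torus.IsClassicalNSSolutionOn.velocity_backward_unique` — two classical solutions of the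
  Navier–Stokes system on `[a, b] × T^d` with the same viscosity `ν > 0` and the same force which
  **agree at the final time** `t = b` agree on all of `[a, b]`; equivalently the solution maps
  `S(t) : u(s) ↦ u(s + t)` of the classical Navier–Stokes dynamics are injective (Temam 1997,
  Ch. III §6: "backward uniqueness for all time is equivalent to the injectivity of `S(t)`";
  Constantin–Foias 1988, Ch. 12, Theorem 12.2 and Prop. 13.1 (iv));
* `Torus.IsClassicalNSSolutionOn.velocity_backward_unique_of_mem`,
  `Torus.IsClassicalNSSolutionOn.velocity_eq_of_eq` — on a convex time set (e.g. `Ici a`, the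
  setting of semiflows), agreement at one time gives agreement at all earlier times, resp. at all
  times (combined with the forward uniqueness `….velocity_unique_of_mem`).

Proof road (the log-convexity / Dirichlet-quotient method of Agmon–Nirenberg and Ogawa in the form
of Bardos–Tartar and Ghidaglia, as in Temam 1997, Ch. III §6.1, Lemmas 6.1–6.2, applied to
Navier–Stokes in §6.2, (6.16)–(6.17)): the difference `w = u₁ - u₂` solves
`∂ₜw = νΔw - C - ∇(p₁ - p₂)`, `div w = 0`, `C = (u₁·∇)w + (w·∇)u₂`. With `E = ∫ ‖w‖²`,
`V = ‖∇w‖₂² = -∫⟪Δw, w⟫` (`Torus.gradNormSq`) the balance laws `E' = -2νV - 2∫⟪(w·∇)u₂, w⟫`,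
`V' = -2ν‖Δw‖₂² + 2∫⟪C, Δw⟫` and the coefficient bounds `|∫⟪(w·∇)u₂, w⟫| ≤ LE`,
`‖C‖₂² ≤ 2|d|M²V + 2L²E` (`sup ‖u₁‖ ≤ M`, `sup ‖∂ᵢu₂‖ ≤ Cᵢ`, `L = ∑ᵢ Cᵢ` on the compact
`[a, b] × T^d`) are in `TorusClassicalNSDifferenceBalances` / `TorusLinearisedNSEnergy`. Here:

* `Torus.integral_inner_laplacian_add_smul_le` — Young's inequality
  `∫⟪C, Δw + λw⟫ ≤ ν‖Δw + λw‖₂² + ‖C‖₂²/(4ν)`, expanded in `λ`;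
* `Literature.Analysis.ODE.dirichletQuotient_law_of_young` — at `λ = V/E` this is the
  Dirichlet-quotient law `V'E - VE' ≤ ‖C‖₂²E/(2ν)` (Temam's (6.11):
  `½Λ' + ‖(Δ + Λ)w‖²/‖w‖² ≤ ‖C‖²/(2ν‖w‖²)`), hence `≤ K(V + E)E`, `K = (|d|M² + L²)/ν`;
* the energy inequality `E' ≥ -(2νV + 2LE)`;
* the real-variable conclusion `Literature.Analysis.ODE.eq_zero_of_dirichletQuotient_law`
  (`ODE/LogConvexityBackwardUniqueness`: `Λ = V/E` stays bounded on intervals of positivity, so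
  `(log E)' ≥ -M` and `E` cannot reach zero unless `E ≡ 0`).

Valid in every dimension `d`; no interpolation inequality is needed because the solutions are
smooth on the compact `[a, b] × T^d` (bounded coefficients). What is NOT here: backward uniqueness
for weak / strong non-smooth solutions (Temam's `k ∈ L²(0, T)` version), the inviscid case `ν = 0`
(`FluidPDE/EulerTorusUniqueness`), and any continuous dependence backward in time (the backward
problem is ill-posed).

## Mathlib / tree search

Tree: `lean search 'backward_unique|BackwardUnique|dirichletQuotient'` — only the inviscid
`Torus.IsEulerReynoldsOn.unique` and the Summits-side singular-weight log-convexity files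
(`RellichScarScarRigidityLogConvexity*`, not importable); reused: the
`TorusClassicalNSDifferenceBalances` API above, `Torus.integral_inner_convect_self_right_eq_zero`,
`Torus.eq_zero_of_integral_norm_sq_nonpos`,
`….velocity_unique_of_mem`, `….mono` (`TorusClassicalNSUniqueness`, `TorusClassicalNSGluing`),
`Torus.integral_inner_laplacian_self_eq_neg_gradNormSq` (`FluidPDE/TorusClassicalHnBalance`),
`Torus.IsSmoothSpaceTimeOn.exists_norm_le_of_isCompact`. Mathlib: `norm_add_sq_real`,
`real_inner_le_norm`, `integral_mono`, `field_simp`/`nlinarith` for the algebra.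

## References

* R. Temam, *Infinite-Dimensional Dynamical Systems in Mechanics and Physics*, 2nd ed., Springer
  1997, Ch. III §6.1 (Lemmas 6.1, 6.2, Remark 6.1) and §6.2 ((6.16)–(6.17), the Navier–Stokes
  case). [Temam1997]
* P. Constantin, C. Foias, *Navier–Stokes Equations*, Univ. Chicago Press 1988, Ch. 12,
  Theorem 12.2 (backward uniqueness; periodic case included) and Prop. 13.1 (iv) (injectivity of
  `S(t)`). [ConstantinFoiasNSE1988]
-/

open MeasureTheory Set Filter
open scoped InnerProductSpace ContDiff Topology

noncomputable section

namespace Literature.Analysis.ODE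

/-- **The Dirichlet-quotient law from Young's inequality (Temam 1997, Ch. III, (6.11)).** Pure
algebra: if `P + λQ ≤ ν(D + 2λJ + λ²E) + N/(4ν)` for all real `λ` (the expanded form of
`⟨C, (Δ + λ)w⟩ ≤ ν‖(Δ + λ)w‖² + ‖C‖²/(4ν)` with `P = ⟨C, Δw⟩`, `Q = ⟨C, w⟩`, `D = ‖Δw‖²`,
`J = ⟨Δw, w⟩ = -V`, `E = ‖w‖²`, `N = ‖C‖²`), and `E > 0`, then at `λ = V/E`:
`(-2νD + 2P)E - V(-2νV - 2Q) ≤ (N/(2ν)) E`, i.e. `V'E - VE' ≤ ‖C‖²E/(2ν)`. [cite: Temam1997, Ch. III §6.1 Lemma 6.1 (6.11)] -/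
theorem dirichletQuotient_law_of_young {E V D P Q N ν : ℝ} (hE : 0 < E) (hν : 0 < ν)
    (h : ∀ l : ℝ, P + l * Q ≤ ν * (D + 2 * l * -V + l ^ 2 * E) + (4 * ν)⁻¹ * N) :
    (-(2 * ν * D) + 2 * P) * E - V * (-(2 * ν * V) - 2 * Q) ≤ N / (2 * ν) * E := by
  have h1 := mul_le_mul_of_nonneg_left (h (V / E)) hE.le
  have e1 : E * (P + V / E * Q) = E * P + V * Q := by
    field_simp
  have e2 : E * (ν * (D + 2 * (V / E) * -V + (V / E) ^ 2 * E) + (4 * ν)⁻¹ * N) =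
      ν * (D * E - V ^ 2) + N / (4 * ν) * E := by
    field_simp
    ring
  rw [e1, e2] at h1
  have e3 : N / (2 * ν) * E = 2 * (N / (4 * ν) * E) := by
    field_simp
    ring
  rw [e3]
  nlinarith [h1]

end Literature.Analysis.ODE

namespace Literature.Analysis.FunctionSpaces

namespace Torus

variable {d : Type*} [Fintype d] [DecidableEq d]

/-! ## Young's inequality in the form used by the Dirichlet-quotient argument -/

section Young

omit [DecidableEq d] in
/-- **Young's inequality for the Dirichlet-quotient argument**, expanded in `λ`: for smooth `C`,
`w` on `T^d` and `ν > 0`,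
`∫⟪C, Δw⟫ + λ∫⟪C, w⟫ ≤ ν (∫‖Δw‖² + 2λ∫⟪Δw, w⟫ + λ²∫‖w‖²) + (4ν)⁻¹ ∫‖C‖²`, i.e.
`⟨C, (Δ + λ)w⟩ ≤ ν‖(Δ + λ)w‖² + ‖C‖²/(4ν)` pointwise `⟪c, y⟫ ≤ ν‖y‖² + ‖c‖²/(4ν)` integrated
(Temam 1997, proof of Lemma 6.1). [folklore] -/
theorem integral_inner_laplacian_add_smul_le {G : Type*} [NormedAddCommGroup G]
    [InnerProductSpace ℝ G] {C w : UnitAddTorus d → G} (hC : IsSmooth C) (hw : IsSmooth w)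
    {ν : ℝ} (hν : 0 < ν) (l : ℝ) :
    (∫ x, ⟪C x, laplacian w x⟫_ℝ) + l * ∫ x, ⟪C x, w x⟫_ℝ ≤
      ν * ((∫ x, ‖laplacian w x‖ ^ 2) + 2 * l * (∫ x, ⟪laplacian w x, w x⟫_ℝ) +
        l ^ 2 * ∫ x, ‖w x‖ ^ 2) + (4 * ν)⁻¹ * ∫ x, ‖C x‖ ^ 2 := by
  have hΔ : IsSmooth (laplacian w) := hw.laplacian
  have hY : IsSmooth (fun x => laplacian w x + l • w x) := hΔ.add (hw.smul l)
  -- pointwise Young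
  have hpt : ∀ x, ⟪C x, laplacian w x + l • w x⟫_ℝ ≤
      ν * ‖laplacian w x + l • w x‖ ^ 2 + (4 * ν)⁻¹ * ‖C x‖ ^ 2 := by
    intro x
    set y := laplacian w x + l • w x
    have h1 : ⟪C x, y⟫_ℝ ≤ ‖C x‖ * ‖y‖ := real_inner_le_norm _ _
    have h2 : 4 * ν * (‖C x‖ * ‖y‖) ≤ 4 * ν * (ν * ‖y‖ ^ 2) + ‖C x‖ ^ 2 := by
      nlinarith [sq_nonneg (2 * ν * ‖y‖ - ‖C x‖), norm_nonneg (C x), norm_nonneg y]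
    have h3 : ‖C x‖ * ‖y‖ ≤ ν * ‖y‖ ^ 2 + (4 * ν)⁻¹ * ‖C x‖ ^ 2 := by
      rw [← sub_nonneg]
      have e : ν * ‖y‖ ^ 2 + (4 * ν)⁻¹ * ‖C x‖ ^ 2 - ‖C x‖ * ‖y‖ =
          (4 * ν)⁻¹ * (4 * ν * (ν * ‖y‖ ^ 2) + ‖C x‖ ^ 2 - 4 * ν * (‖C x‖ * ‖y‖)) := by
        field_simp
      rw [e]
      exact mul_nonneg (by positivity) (by linarith)
    exact h1.trans h3
  -- integrate
  have hiL : Integrable (fun x => ⟪C x, laplacian w x + l • w x⟫_ℝ) volume := (hC.inner hY).integrable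
  have hiR : Integrable (fun x => ν * ‖laplacian w x + l • w x‖ ^ 2 + (4 * ν)⁻¹ * ‖C x‖ ^ 2) volume :=
    (hY.norm_sq.integrable.const_mul ν).add (hC.norm_sq.integrable.const_mul _)
  have hint := integral_mono hiL hiR hpt
  -- expand both sides
  have hl : ∫ x, ⟪C x, laplacian w x + l • w x⟫_ℝ =
      (∫ x, ⟪C x, laplacian w x⟫_ℝ) + l * ∫ x, ⟪C x, w x⟫_ℝ := by
    simp_rw [inner_add_right, real_inner_smul_right]
    rw [integral_add (hC.inner hΔ).integrable ((hC.inner hw).integrable.const_mul l),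
      integral_const_mul]
  have hr : ∫ x, (ν * ‖laplacian w x + l • w x‖ ^ 2 + (4 * ν)⁻¹ * ‖C x‖ ^ 2) =
      ν * ((∫ x, ‖laplacian w x‖ ^ 2) + 2 * l * (∫ x, ⟪laplacian w x, w x⟫_ℝ) +
        l ^ 2 * ∫ x, ‖w x‖ ^ 2) + (4 * ν)⁻¹ * ∫ x, ‖C x‖ ^ 2 := by
    have hsq : ∀ x, ‖laplacian w x + l • w x‖ ^ 2 =
        ‖laplacian w x‖ ^ 2 + 2 * l * ⟪laplacian w x, w x⟫_ℝ + l ^ 2 * ‖w x‖ ^ 2 := by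
      intro x
      rw [norm_add_sq_real, real_inner_smul_right, norm_smul, mul_pow, Real.norm_eq_abs, sq_abs]
      ring
    have i1 : Integrable (fun x => ‖laplacian w x‖ ^ 2) volume := hΔ.norm_sq.integrable
    have i2 : Integrable (fun x => 2 * l * ⟪laplacian w x, w x⟫_ℝ) volume :=
      (hΔ.inner hw).integrable.const_mul _
    have i3 : Integrable (fun x => l ^ 2 * ‖w x‖ ^ 2) volume := hw.norm_sq.integrable.const_mul _
    have i12 : Integrable (fun x => ‖laplacian w x‖ ^ 2 + 2 * l * ⟪laplacian w x, w x⟫_ℝ) volume :=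
      i1.add i2
    rw [integral_add (hY.norm_sq.integrable.const_mul ν) (hC.norm_sq.integrable.const_mul _),
      integral_const_mul, integral_const_mul]
    simp_rw [hsq]
    rw [integral_add i12 i3, integral_add i1 i2, integral_const_mul, integral_const_mul]
  rw [hl, hr] at hint
  exact hint

end Young

/-! ## Backward uniqueness -/

section Main

/-- **Backward uniqueness of classical Navier–Stokes solutions on the torus** (Temam 1997,
Ch. III §6, Lemma 6.2 with §6.2; Constantin–Foias 1988, Theorem 12.2): two classical solutions of
the Navier–Stokes system on `[a, b] × T^d` with the same viscosity `ν > 0` and the same force which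
agree at the final time `b` agree on `[a, b]`. Proof: the energy `E = ∫‖w‖²` and `V = ‖∇w‖₂²` of
`w = u₁ - u₂` satisfy `E' ≥ -(2νV + 2LE)` and the Dirichlet-quotient law
`V'E - VE' ≤ K(V + E)E`, `K = (|d|M² + L²)/ν`, so `E(b) = 0` forces `E ≡ 0`
(`Literature.Analysis.ODE.eq_zero_of_dirichletQuotient_law`). [cite: Temam1997, Ch. III §6.1 Lemma 6.2 and §6.2 (6.16)–(6.17)] -/
theorem IsClassicalNSSolutionOn.velocity_backward_unique
    {a b ν : ℝ} (hν : 0 < ν) (hab : a < b) {f u₁ u₂ : ℝ → UnitAddTorus d → EuclideanSpace ℝ d}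
    {p₁ p₂ : ℝ → UnitAddTorus d → ℝ} (h₁ : IsClassicalNSSolutionOn (Icc a b) ν f u₁ p₁)
    (h₂ : IsClassicalNSSolutionOn (Icc a b) ν f u₂ p₂) (hb : u₁ b = u₂ b) :
    ∀ t ∈ Icc a b, u₁ t = u₂ t := by
  classical
  intro t ht
  have hU : UniqueDiffOn ℝ (Icc a b) := uniqueDiffOn_Icc hab
  set w : ℝ → UnitAddTorus d → EuclideanSpace ℝ d := fun s y => u₁ s y - u₂ s y with hw_def
  have hw : IsSmoothSpaceTimeOn (Icc a b) w := h₁.smooth_velocity.sub h₂.smooth_velocity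
  -- uniform bounds on the compact `[a, b] × T^d`
  obtain ⟨M, hM⟩ : ∃ M : ℝ, ∀ s ∈ Icc a b, ∀ x, ‖u₁ s x‖ ≤ M :=
    h₁.smooth_velocity.exists_norm_le_of_isCompact isCompact_Icc subset_rfl
  obtain ⟨C, hC⟩ : ∃ C : d → ℝ, ∀ i, ∀ s ∈ Icc a b, ∀ x, ‖partialDeriv i (u₂ s) x‖ ≤ C i := by
    have hbd : ∀ i : d, ∃ c : ℝ, ∀ s ∈ Icc a b, ∀ x, ‖partialDeriv i (u₂ s) x‖ ≤ c := fun i =>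
      (h₂.smooth_velocity.partialDeriv hU i).exists_norm_le_of_isCompact isCompact_Icc subset_rfl
    choose C hC using hbd
    exact ⟨C, hC⟩
  set L : ℝ := ∑ i, C i with hL_def
  set K : ℝ := (Fintype.card d * M ^ 2 + L ^ 2) / ν with hK_def
  have hK0 : 0 ≤ K := by positivity
  -- the two functions of time and their derivatives
  set E : ℝ → ℝ := fun s => ∫ x, ‖w s x‖ ^ 2 with hE_def
  set V : ℝ → ℝ := fun s => gradNormSq (w s) with hV_def
  set R : ℝ → ℝ := fun s => ∫ x, ⟪convect (w s) (u₂ s) x, w s x⟫_ℝ with hR_def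
  set D : ℝ → ℝ := fun s => ∫ x, ‖laplacian (w s) x‖ ^ 2 with hD_def
  set P : ℝ → ℝ := fun s => ∫ x, ⟪convect (u₁ s) (w s) x + convect (w s) (u₂ s) x,
    laplacian (w s) x⟫_ℝ with hP_def
  set E' : ℝ → ℝ := fun s => -(2 * ν * V s) - 2 * R s with hE'_def
  set V' : ℝ → ℝ := fun s => -(2 * ν * D s) + 2 * P s with hV'_def
  have hE : ∀ s ∈ Icc a b, HasDerivWithinAt E (E' s) (Icc a b) s := fun s hs =>
    h₁.hasDerivWithinAt_integral_norm_sq_sub h₂ hab hs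
  have hV : ∀ s ∈ Icc a b, HasDerivWithinAt V (V' s) (Icc a b) s := fun s hs =>
    h₁.hasDerivWithinAt_gradNormSq_sub h₂ hab hs
  have hE0 : ∀ s ∈ Icc a b, 0 ≤ E s := fun s _ => integral_nonneg fun x => sq_nonneg _
  have hV0 : ∀ s ∈ Icc a b, 0 ≤ V s := fun s _ => gradNormSq_nonneg _
  -- the energy inequality `E' ≥ -(2νV + 2LE)`
  have hlow : ∀ s ∈ Icc a b, 0 < E s → -(2 * ν * V s + 2 * L * E s) ≤ E' s := by
    intro s hs _
    have hR := abs_integral_inner_convect_le (h₂.smooth_velocity.isSmooth_slice hs)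
      (hw.isSmooth_slice hs) fun i x => hC i s hs x
    have hR' := (abs_le.1 hR).2
    simp only [hE'_def]
    linarith
  -- the Dirichlet-quotient law `V'E - VE' ≤ K(V + E)E`
  have hquot : ∀ s ∈ Icc a b, 0 < E s → V' s * E s - V s * E' s ≤ K * (V s + E s) * E s := by
    intro s hs hEs
    have hws : IsSmooth (w s) := hw.isSmooth_slice hs
    have hu₁s : IsSmooth (u₁ s) := h₁.smooth_velocity.isSmooth_slice hs
    have hu₂s : IsSmooth (u₂ s) := h₂.smooth_velocity.isSmooth_slice hs
    have hCs : IsSmooth (fun x => convect (u₁ s) (w s) x + convect (w s) (u₂ s) x) :=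
      (hu₁s.convect hws).add (hws.convect hu₂s)
    set Q : ℝ := ∫ x, ⟪convect (u₁ s) (w s) x + convect (w s) (u₂ s) x, w s x⟫_ℝ with hQ_def
    set N : ℝ := ∫ x, ‖convect (u₁ s) (w s) x + convect (w s) (u₂ s) x‖ ^ 2 with hN_def
    -- `Q = R s`: the transport term vanishes
    have hQR : Q = R s := by
      simp only [hQ_def, hR_def]
      simp_rw [inner_add_left]
      rw [integral_add (((hu₁s.convect hws).inner hws).integrable)
          (((hws.convect hu₂s).inner hws).integrable),
        integral_inner_convect_self_right_eq_zero hu₁s (h₁.divFree s hs) hws, zero_add]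
    -- `∫ ⟪Δw, w⟫ = -V`
    have hJ : ∫ x, ⟪laplacian (w s) x, w s x⟫_ℝ = -V s :=
      Literature.Analysis.FluidPDE.Torus.integral_inner_laplacian_self_eq_neg_gradNormSq hws
    -- Young, for every `λ`
    have hyoung : ∀ l : ℝ, P s + l * Q ≤ ν * (D s + 2 * l * -V s + l ^ 2 * E s) + (4 * ν)⁻¹ * N := by
      intro l
      have h := integral_inner_laplacian_add_smul_le hCs hws hν l
      rw [hJ] at h
      exact h
    have hlaw := Literature.Analysis.ODE.dirichletQuotient_law_of_young hEs hν hyoung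
    -- `N ≤ 2|d|M²V + 2L²E`
    have hN : N ≤ 2 * (Fintype.card d * M ^ 2) * V s + 2 * L ^ 2 * E s :=
      integral_norm_sq_convect_add_convect_le hu₂s hws (fun x => hM s hs x) fun i x => hC i s hs x
    have hNK : N / (2 * ν) * E s ≤ K * (V s + E s) * E s := by
      refine mul_le_mul_of_nonneg_right ?_ hEs.le
      rw [div_le_iff₀ (by positivity : (0 : ℝ) < 2 * ν)]
      have e : K * (V s + E s) * (2 * ν) =
          2 * ((Fintype.card d * M ^ 2 + L ^ 2) * (V s + E s)) := by
        simp only [hK_def]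
        field_simp
      rw [e]
      have hVs := hV0 s hs
      have h1 : 0 ≤ Fintype.card d * M ^ 2 * E s := by positivity
      have h2 : 0 ≤ L ^ 2 * V s := by positivity
      nlinarith [hN, h1, h2]
    have hrew : V' s * E s - V s * E' s =
        (-(2 * ν * D s) + 2 * P s) * E s - V s * (-(2 * ν * V s) - 2 * Q) := by
      rw [hQR]
    rw [hrew]
    exact hlaw.trans hNK
  -- conclusion
  have hEb : E b = 0 := by
    simp [hE_def, hw_def, hb]
  have hEt : E t = 0 := Literature.Analysis.ODE.eq_zero_of_dirichletQuotient_law hE hV hE0 hV0 hK0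
    (by positivity) hlow hquot hEb ht
  have hwt : IsSmooth (u₁ t - u₂ t) :=
    (h₁.smooth_velocity.isSmooth_slice ht).sub (h₂.smooth_velocity.isSmooth_slice ht)
  exact sub_eq_zero.1 (eq_zero_of_integral_norm_sq_nonpos hwt (le_of_eq hEt))

end Main

/-! ## Anchored versions on convex time sets -/

section Anchors

variable {S : Set ℝ} {ν : ℝ} {f u₁ u₂ : ℝ → UnitAddTorus d → EuclideanSpace ℝ d}
  {p₁ p₂ : ℝ → UnitAddTorus d → ℝ}

/-- **Backward uniqueness from any anchor time.** Two classical solutions with the same viscosity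
`ν > 0` and force on a convex time set `S` which agree at `t₀ ∈ S` agree at every earlier time of
`S` (restrict both to `[t, t₀] ⊆ S` and apply `….velocity_backward_unique`).
[cite: Temam1997, Ch. III §6.1 Lemma 6.2] -/
theorem IsClassicalNSSolutionOn.velocity_backward_unique_of_mem (hν : 0 < ν) (hS : Convex ℝ S)
    (h₁ : IsClassicalNSSolutionOn S ν f u₁ p₁) (h₂ : IsClassicalNSSolutionOn S ν f u₂ p₂)
    {t₀ : ℝ} (ht₀ : t₀ ∈ S) (h0 : u₁ t₀ = u₂ t₀) {t : ℝ} (ht : t ∈ S) (htt₀ : t ≤ t₀) :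
    u₁ t = u₂ t := by
  rcases eq_or_lt_of_le htt₀ with rfl | hlt
  · exact h0
  · have hsub : Icc t t₀ ⊆ S := hS.ordConnected.out ht ht₀
    have hU : UniqueDiffOn ℝ (Icc t t₀) := uniqueDiffOn_Icc hlt
    exact (h₁.mono hsub hU).velocity_backward_unique hν hlt (h₂.mono hsub hU) h0 t
      ⟨le_rfl, hlt.le⟩

/-- **Classical Navier–Stokes solutions are determined by their value at any one time** (forward
uniqueness `….velocity_unique_of_mem` and backward uniqueness `….velocity_backward_unique_of_mem`):
on a convex time set `S` (e.g. `Ici a`, the setting of semiflows), two classical solutions with the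
same viscosity `ν > 0` and force which agree at some `t₀ ∈ S` agree on all of `S` — the
injectivity of the solution maps `S(t)` (Constantin–Foias 1988, Prop. 13.1 (iv)).
[cite: ConstantinFoiasNSE1988, Ch. 12 Theorem 12.2 and Prop. 13.1 (iv)] -/
theorem IsClassicalNSSolutionOn.velocity_eq_of_eq (hν : 0 < ν) (hS : Convex ℝ S)
    (h₁ : IsClassicalNSSolutionOn S ν f u₁ p₁) (h₂ : IsClassicalNSSolutionOn S ν f u₂ p₂)
    {t₀ : ℝ} (ht₀ : t₀ ∈ S) (h0 : u₁ t₀ = u₂ t₀) {t : ℝ} (ht : t ∈ S) : u₁ t = u₂ t := by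
  rcases le_total t t₀ with h | h
  · exact h₁.velocity_backward_unique_of_mem hν hS h₂ ht₀ h0 ht h
  · exact h₁.velocity_unique_of_mem hν.le hS h₂ ht₀ h0 ht h

end Anchors

end Torus

end Literature.Analysis.FunctionSpaces
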